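import Mathlib
import HarnessLib
import Summits.MatrixMultiplication.MatrixMultiplication.Theorems.FarEdgeDescentSlabVertex

/-!
# Far-edge descent — β-slab certificate tools: claims, bisection in five coordinates, root, leaf cell (model level)

Third input of the β-UNIFORM programme (memo g62 §5.1), the slab analogue of `FarEdgeDescentCertTools`:

* `SlabCellClaim B₀ B₁ z ε Vmin κ u₀ u₁ V₀ V₁ m₀ m₁ W₀ W₁ x₁ x₂`: the pair inequality of the region criterion for
  EVERY `β ∈ [B₀, B₁]` and every region point with `βλ ∈ [u₀,u₁]`, `V ∈ [V₀,V₁]`, `βλ' ∈ [m₀,m₁]`, `V' ∈ [W₀,W₁]`,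
  `x ∈ [x₁,x₂]`; `SlabBoxClaim` = the same on `x ∈ [0,1]`;
* `leafCell5`: a slab cell claim from data (two heights, four tangent coefficients, 2 × 7 multipliers and the two
  32-vertex inequalities of `cellExprM5`, each closed by `norm_num`);
* `xsplit5`, `box_of_cell5`, `split_u`, `split_V5`, `split_m5`, `split_W5`, `split_b` (bisection, incl. in β);
* `regionCriterion_of_slabClaim`: the root box `[0,1] × [Vmin,1] × [0,1] × [Vmin,1]` over the slab gives
  `RegionCriterion β z ε Vmin κ` for every `β ∈ [B₀, B₁]` (`0 < B₀`), to be fed to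
  `FarEdgeDescentSlabFloor.capXLD_of_regionCriterion_slab`.

MODEL level; no `sorry`, no new axioms.
-/

noncomputable section

set_option linter.dupNamespace false

namespace Summit.MatrixMultiplication.MatrixMultiplication.Theorems.FarEdgeDescentSlabTools

open Summit.MatrixMultiplication.MatrixMultiplication.Theorems.FarEdgeDescentBoxVertex
open Summit.MatrixMultiplication.MatrixMultiplication.Theorems.FarEdgeDescentCertTools
open Summit.MatrixMultiplication.MatrixMultiplication.Theorems.FarEdgeDescentSlabVertex
open Summit.MatrixMultiplication.MatrixMultiplication.Theorems.FarEdgeDescentNarrownessPotential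

/-! ## Claims -/

/-- The pair inequality on the slab cell, for every `β ∈ [B₀, B₁]` and every region point of the box
(box coordinates `u = βλ`, `u' = βλ'`). -/
def SlabCellClaim (B₀ B₁ z ε Vmin κ u₀ u₁ V₀ V₁ m₀ m₁ W₀ W₁ x₁ x₂ : ℝ) : Prop :=
  ∀ β lam lam' V V' VP x : ℝ,
    B₀ ≤ β → β ≤ B₁ → u₀ ≤ β * lam → β * lam ≤ u₁ → V₀ ≤ V → V ≤ V₁ → m₀ ≤ β * lam' → β * lam' ≤ m₁ →
    W₀ ≤ V' → V' ≤ W₁ →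
    0 ≤ lam → β * lam ≤ 1 → 0 ≤ lam' → β * lam' ≤ 1 → 0 ≤ V → V ≤ 1 → 0 ≤ V' → V' ≤ 1 →
    β * ((2 * β - 1) * lam - 1) ≤ (β - 1) * V → β * ((2 * β - 1) * lam' - 1) ≤ (β - 1) * V' →
    |1 - (2 * β - 1) * lam| ≤ V ^ 2 → |1 - (2 * β - 1) * lam'| ≤ V' ^ 2 →
    VP * (lam + lam' - (2 * β - 1) * lam * lam') =
      lam' * (1 - β * lam) * V' + lam * (1 - β * lam') * V + z * lam * lam' * V * V' →
    Vmin ≤ VP → x₁ ≤ x → x ≤ x₂ → 0 ≤ x → x ≤ 1 →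
      (1 - (β - 1) * lam') * (lam * (ε + 1 - V)) * x ^ κ +
          (1 - (β - 1) * lam) * (lam' * (ε + 1 - V')) * (1 - x) ^ κ ≤
        (lam + lam' - (2 * β - 1) * lam * lam') * (ε + 1 - VP)

/-- The slab claim on the box for all `x ∈ [0, 1]`. -/
def SlabBoxClaim (B₀ B₁ z ε Vmin κ u₀ u₁ V₀ V₁ m₀ m₁ W₀ W₁ : ℝ) : Prop :=
  SlabCellClaim B₀ B₁ z ε Vmin κ u₀ u₁ V₀ V₁ m₀ m₁ W₀ W₁ 0 1

/-! ## Combinators -/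

/-- Glue two x-cells. -/
theorem xsplit5 {B₀ B₁ z ε Vmin κ u₀ u₁ V₀ V₁ m₀ m₁ W₀ W₁ x₁ xm x₂ : ℝ}
    (h1 : SlabCellClaim B₀ B₁ z ε Vmin κ u₀ u₁ V₀ V₁ m₀ m₁ W₀ W₁ x₁ xm)
    (h2 : SlabCellClaim B₀ B₁ z ε Vmin κ u₀ u₁ V₀ V₁ m₀ m₁ W₀ W₁ xm x₂) :
    SlabCellClaim B₀ B₁ z ε Vmin κ u₀ u₁ V₀ V₁ m₀ m₁ W₀ W₁ x₁ x₂ := by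
  intro β lam lam' V V' VP x e0 e1 a1 a2 a3 a4 a5 a6 a7 a8 b1 b2 b3 b4 b5 b6 b7 b8 c1 c2 c3 c4 hP hVP
    hx1 hx2 hx0 hx1'
  rcases le_total x xm with h | h
  · exact h1 β lam lam' V V' VP x e0 e1 a1 a2 a3 a4 a5 a6 a7 a8 b1 b2 b3 b4 b5 b6 b7 b8 c1 c2 c3 c4 hP hVP
      hx1 h hx0 hx1'
  · exact h2 β lam lam' V V' VP x e0 e1 a1 a2 a3 a4 a5 a6 a7 a8 b1 b2 b3 b4 b5 b6 b7 b8 c1 c2 c3 c4 hP hVP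
      h hx2 hx0 hx1'

/-- A slab box claim is the slab cell claim on `[0, 1]`. -/
theorem box_of_cell5 {B₀ B₁ z ε Vmin κ u₀ u₁ V₀ V₁ m₀ m₁ W₀ W₁ : ℝ}
    (h : SlabCellClaim B₀ B₁ z ε Vmin κ u₀ u₁ V₀ V₁ m₀ m₁ W₀ W₁ 0 1) :
    SlabBoxClaim B₀ B₁ z ε Vmin κ u₀ u₁ V₀ V₁ m₀ m₁ W₀ W₁ := h

/-- Bisection in `u = βλ`. -/
theorem split_u {B₀ B₁ z ε Vmin κ u₀ um u₁ V₀ V₁ m₀ m₁ W₀ W₁ : ℝ}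
    (h1 : SlabBoxClaim B₀ B₁ z ε Vmin κ u₀ um V₀ V₁ m₀ m₁ W₀ W₁)
    (h2 : SlabBoxClaim B₀ B₁ z ε Vmin κ um u₁ V₀ V₁ m₀ m₁ W₀ W₁) :
    SlabBoxClaim B₀ B₁ z ε Vmin κ u₀ u₁ V₀ V₁ m₀ m₁ W₀ W₁ := by
  intro β lam lam' V V' VP x e0 e1 a1 a2 a3 a4 a5 a6 a7 a8 b1 b2 b3 b4 b5 b6 b7 b8 c1 c2 c3 c4 hP hVP
    hx1 hx2 hx0 hx1'
  rcases le_total (β * lam) um with h | h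
  · exact h1 β lam lam' V V' VP x e0 e1 a1 h a3 a4 a5 a6 a7 a8 b1 b2 b3 b4 b5 b6 b7 b8 c1 c2 c3 c4 hP hVP
      hx1 hx2 hx0 hx1'
  · exact h2 β lam lam' V V' VP x e0 e1 h a2 a3 a4 a5 a6 a7 a8 b1 b2 b3 b4 b5 b6 b7 b8 c1 c2 c3 c4 hP hVP
      hx1 hx2 hx0 hx1'

/-- Bisection in `V`. -/
theorem split_V5 {B₀ B₁ z ε Vmin κ u₀ u₁ V₀ Vm V₁ m₀ m₁ W₀ W₁ : ℝ}
    (h1 : SlabBoxClaim B₀ B₁ z ε Vmin κ u₀ u₁ V₀ Vm m₀ m₁ W₀ W₁)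
    (h2 : SlabBoxClaim B₀ B₁ z ε Vmin κ u₀ u₁ Vm V₁ m₀ m₁ W₀ W₁) :
    SlabBoxClaim B₀ B₁ z ε Vmin κ u₀ u₁ V₀ V₁ m₀ m₁ W₀ W₁ := by
  intro β lam lam' V V' VP x e0 e1 a1 a2 a3 a4 a5 a6 a7 a8 b1 b2 b3 b4 b5 b6 b7 b8 c1 c2 c3 c4 hP hVP
    hx1 hx2 hx0 hx1'
  rcases le_total V Vm with h | h
  · exact h1 β lam lam' V V' VP x e0 e1 a1 a2 a3 h a5 a6 a7 a8 b1 b2 b3 b4 b5 b6 b7 b8 c1 c2 c3 c4 hP hVP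
      hx1 hx2 hx0 hx1'
  · exact h2 β lam lam' V V' VP x e0 e1 a1 a2 h a4 a5 a6 a7 a8 b1 b2 b3 b4 b5 b6 b7 b8 c1 c2 c3 c4 hP hVP
      hx1 hx2 hx0 hx1'

/-- Bisection in `u' = βλ'`. -/
theorem split_m5 {B₀ B₁ z ε Vmin κ u₀ u₁ V₀ V₁ m₀ mm m₁ W₀ W₁ : ℝ}
    (h1 : SlabBoxClaim B₀ B₁ z ε Vmin κ u₀ u₁ V₀ V₁ m₀ mm W₀ W₁)
    (h2 : SlabBoxClaim B₀ B₁ z ε Vmin κ u₀ u₁ V₀ V₁ mm m₁ W₀ W₁) :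
    SlabBoxClaim B₀ B₁ z ε Vmin κ u₀ u₁ V₀ V₁ m₀ m₁ W₀ W₁ := by
  intro β lam lam' V V' VP x e0 e1 a1 a2 a3 a4 a5 a6 a7 a8 b1 b2 b3 b4 b5 b6 b7 b8 c1 c2 c3 c4 hP hVP
    hx1 hx2 hx0 hx1'
  rcases le_total (β * lam') mm with h | h
  · exact h1 β lam lam' V V' VP x e0 e1 a1 a2 a3 a4 a5 h a7 a8 b1 b2 b3 b4 b5 b6 b7 b8 c1 c2 c3 c4 hP hVP
      hx1 hx2 hx0 hx1'
  · exact h2 β lam lam' V V' VP x e0 e1 a1 a2 a3 a4 h a6 a7 a8 b1 b2 b3 b4 b5 b6 b7 b8 c1 c2 c3 c4 hP hVP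
      hx1 hx2 hx0 hx1'

/-- Bisection in `V'`. -/
theorem split_W5 {B₀ B₁ z ε Vmin κ u₀ u₁ V₀ V₁ m₀ m₁ W₀ Wm W₁ : ℝ}
    (h1 : SlabBoxClaim B₀ B₁ z ε Vmin κ u₀ u₁ V₀ V₁ m₀ m₁ W₀ Wm)
    (h2 : SlabBoxClaim B₀ B₁ z ε Vmin κ u₀ u₁ V₀ V₁ m₀ m₁ Wm W₁) :
    SlabBoxClaim B₀ B₁ z ε Vmin κ u₀ u₁ V₀ V₁ m₀ m₁ W₀ W₁ := by
  intro β lam lam' V V' VP x e0 e1 a1 a2 a3 a4 a5 a6 a7 a8 b1 b2 b3 b4 b5 b6 b7 b8 c1 c2 c3 c4 hP hVP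
    hx1 hx2 hx0 hx1'
  rcases le_total V' Wm with h | h
  · exact h1 β lam lam' V V' VP x e0 e1 a1 a2 a3 a4 a5 a6 a7 h b1 b2 b3 b4 b5 b6 b7 b8 c1 c2 c3 c4 hP hVP
      hx1 hx2 hx0 hx1'
  · exact h2 β lam lam' V V' VP x e0 e1 a1 a2 a3 a4 a5 a6 h a8 b1 b2 b3 b4 b5 b6 b7 b8 c1 c2 c3 c4 hP hVP
      hx1 hx2 hx0 hx1'

/-- Bisection in `β`. -/
theorem split_b {B₀ Bm B₁ z ε Vmin κ u₀ u₁ V₀ V₁ m₀ m₁ W₀ W₁ : ℝ}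
    (h1 : SlabBoxClaim B₀ Bm z ε Vmin κ u₀ u₁ V₀ V₁ m₀ m₁ W₀ W₁)
    (h2 : SlabBoxClaim Bm B₁ z ε Vmin κ u₀ u₁ V₀ V₁ m₀ m₁ W₀ W₁) :
    SlabBoxClaim B₀ B₁ z ε Vmin κ u₀ u₁ V₀ V₁ m₀ m₁ W₀ W₁ := by
  intro β lam lam' V V' VP x e0 e1 a1 a2 a3 a4 a5 a6 a7 a8 b1 b2 b3 b4 b5 b6 b7 b8 c1 c2 c3 c4 hP hVP
    hx1 hx2 hx0 hx1'
  rcases le_total β Bm with h | h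
  · exact h1 β lam lam' V V' VP x e0 h a1 a2 a3 a4 a5 a6 a7 a8 b1 b2 b3 b4 b5 b6 b7 b8 c1 c2 c3 c4 hP hVP
      hx1 hx2 hx0 hx1'
  · exact h2 β lam lam' V V' VP x h e1 a1 a2 a3 a4 a5 a6 a7 a8 b1 b2 b3 b4 b5 b6 b7 b8 c1 c2 c3 c4 hP hVP
      hx1 hx2 hx0 hx1'

/-- **Root.**  The slab claim on `[0,1] × [Vmin,1] × [0,1] × [Vmin,1]` gives the region criterion for every
`β ∈ [B₀, B₁]` (`0 < B₀`, `0 ≤ Vmin`). -/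
theorem regionCriterion_of_slabClaim {B₀ B₁ z ε Vmin κ : ℝ} (hB : 0 < B₀) (hV : 0 ≤ Vmin)
    (h : SlabBoxClaim B₀ B₁ z ε Vmin κ 0 1 Vmin 1 0 1 Vmin 1) :
    ∀ β : ℝ, B₀ ≤ β → β ≤ B₁ → RegionCriterion β z ε Vmin κ := by
  intro β e0 e1 lam lam' V V' VP hl hl1 hl' hl1' hVm hV1 hVm' hV1' hW hW' hQ hQ' hP hVP x hx0 hx1
  have hβ : 0 ≤ β := hB.le.trans e0
  exact h β lam lam' V V' VP x e0 e1 (mul_nonneg hβ hl.le) hl1 hVm hV1 (mul_nonneg hβ hl'.le) hl1' hVm'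
    hV1' hl.le hl1 hl'.le hl1' (hV.trans hVm) hV1 (hV.trans hVm') hV1' hW hW' hQ hQ' hP hVP hx0 hx1 hx0 hx1

/-! ## Leaf cell from data -/

/-- **Slab leaf cell from data** (as `FarEdgeDescentCertTools.leafCell`, with the two endpoint inequalities
from the 32-vertex checks of `cellExprM5`; `0 < B₀`). -/
theorem leafCell5 {B₀ B₁ z ε Vmin κ u₀ u₁ V₀ V₁ m₀ m₁ W₀ W₁ x₁ x₂ ρ σ ca₁ cb₁ ca₂ cb₂ : ℝ}
    {μ₁ μ₂ μ₃ μ₄ μ₅ μ₆ μ₇ ν₁ ν₂ ν₃ ν₄ ν₅ ν₆ ν₇ : ℝ}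
    (hB : 0 < B₀) (hε : 0 ≤ ε) (hκ : 17 / 41 ≤ κ) (hκ1 : κ ≤ 1)
    (hx₁ : 0 ≤ x₁) (hx12 : x₁ < x₂) (hx₂ : x₂ ≤ 1) (hρ : x₂ ^ κ ≤ ρ) (hσ : (1 - x₁) ^ κ ≤ σ)
    (hca₁ : ρ * (1 + 17 / 41 * (x₁ / x₂ - 1)) ≤ ca₁) (hcb₁ : σ ≤ cb₁) (hca₂ : ρ ≤ ca₂)
    (hcb₂ : σ * (1 + 17 / 41 * ((1 - x₂) / (1 - x₁) - 1)) ≤ cb₂)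
    (hμ : 0 ≤ μ₁ ∧ 0 ≤ μ₂ ∧ 0 ≤ μ₃ ∧ 0 ≤ μ₄ ∧ 0 ≤ μ₅ ∧ 0 ≤ μ₆ ∧ 0 ≤ μ₇)
    (hν : 0 ≤ ν₁ ∧ 0 ≤ ν₂ ∧ 0 ≤ ν₃ ∧ 0 ≤ ν₄ ∧ 0 ≤ ν₅ ∧ 0 ≤ ν₆ ∧ 0 ≤ ν₇)
    (hv₁ : ∀ a b c d e : ℝ, (a = u₀ ∨ a = u₁) → (b = m₀ ∨ b = m₁) → (c = V₀ ∨ c = V₁) → (d = W₀ ∨ d = W₁) →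
      (e = B₀ ∨ e = B₁) → 0 ≤ cellExprM5 z ε Vmin ca₁ cb₁ V₀ V₁ W₀ W₁ μ₁ μ₂ μ₃ μ₄ μ₅ μ₆ μ₇ a b c d e)
    (hv₂ : ∀ a b c d e : ℝ, (a = u₀ ∨ a = u₁) → (b = m₀ ∨ b = m₁) → (c = V₀ ∨ c = V₁) → (d = W₀ ∨ d = W₁) →
      (e = B₀ ∨ e = B₁) → 0 ≤ cellExprM5 z ε Vmin ca₂ cb₂ V₀ V₁ W₀ W₁ ν₁ ν₂ ν₃ ν₄ ν₅ ν₆ ν₇ a b c d e) :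
    SlabCellClaim B₀ B₁ z ε Vmin κ u₀ u₁ V₀ V₁ m₀ m₁ W₀ W₁ x₁ x₂ := by
  intro β lam lam' V V' VP x e0 e1 a1 a2 a3 a4 a5 a6 a7 a8 b1 b2 b3 b4 b5 b6 b7 b8 c1 c2 c3 c4 hP hVP
    hx1 hx2 hx0 hx1'
  have hβ : 0 < β := lt_of_lt_of_le hB e0
  obtain ⟨hμ₁, hμ₂, hμ₃, hμ₄, hμ₅, hμ₆, hμ₇⟩ := hμ
  obtain ⟨hν₁, hν₂, hν₃, hν₄, hν₅, hν₆, hν₇⟩ := hν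
  have E1 := cellM5 hμ₁ hμ₂ hμ₃ hμ₄ hμ₅ hμ₆ hμ₇ hv₁ hβ e0 e1 a1 a2 a3 a4 a5 a6 a7 a8 b1 b2 b3 b4 c1 c2 c3 c4
    hP hVP
  have E2 := cellM5 hν₁ hν₂ hν₃ hν₄ hν₅ hν₆ hν₇ hv₂ hβ e0 e1 a1 a2 a3 a4 a5 a6 a7 a8 b1 b2 b3 b4 c1 c2 c3 c4
    hP hVP
  set A := (1 - (β - 1) * lam') * (lam * (ε + 1 - V)) with hA_def
  set B := (1 - (β - 1) * lam) * (lam' * (ε + 1 - V')) with hB_def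
  set R := (lam + lam' - (2 * β - 1) * lam * lam') * (ε + 1 - VP) with hR_def
  have hA : 0 ≤ A := by
    have : (β - 1) * lam' ≤ β * lam' := mul_le_mul_of_nonneg_right (by linarith) b3
    exact mul_nonneg (by linarith) (mul_nonneg b1 (by linarith))
  have hB : 0 ≤ B := by
    have : (β - 1) * lam ≤ β * lam := mul_le_mul_of_nonneg_right (by linarith) b1
    exact mul_nonneg (by linarith) (mul_nonneg b3 (by linarith))
  have hx2pos : 0 < x₂ := lt_of_le_of_lt hx₁ hx12
  have h1x1 : 0 < 1 - x₁ := by linarith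
  have hκ0 : (0:ℝ) ≤ 17 / 41 := by norm_num
  have T1 : x ^ κ ≤ ρ * (1 + 17 / 41 * (x / x₂ - 1)) := tangent_right hx0 hx2 hx2pos hκ hκ0 hκ1 hρ
  have T2 : (1 - x) ^ κ ≤ σ * (1 + 17 / 41 * ((1 - x) / (1 - x₁) - 1)) :=
    tangent_right (by linarith) (by linarith) h1x1 hκ hκ0 hκ1 hσ
  have M : A * x ^ κ + B * (1 - x) ^ κ ≤
      A * (ρ * (1 + 17 / 41 * (x / x₂ - 1))) + B * (σ * (1 + 17 / 41 * ((1 - x) / (1 - x₁) - 1))) := by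
    have := mul_le_mul_of_nonneg_left T1 hA
    have := mul_le_mul_of_nonneg_left T2 hB
    linarith
  have P1 : A * (ρ * (1 + 17 / 41 * (x₁ / x₂ - 1))) + B * (σ * (1 + 17 / 41 * ((1 - x₁) / (1 - x₁) - 1))) ≤ R := by
    have e : (1 - x₁) / (1 - x₁) = 1 := div_self h1x1.ne'
    rw [e]
    have u1 := mul_le_mul_of_nonneg_left hca₁ hA
    have u2 : B * (σ * (1 + 17 / 41 * (1 - 1))) ≤ B * cb₁ := by
      have : σ * (1 + 17 / 41 * (1 - 1)) = σ := by ring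
      rw [this]; exact mul_le_mul_of_nonneg_left hcb₁ hB
    linarith [E1]
  have P2 : A * (ρ * (1 + 17 / 41 * (x₂ / x₂ - 1))) + B * (σ * (1 + 17 / 41 * ((1 - x₂) / (1 - x₁) - 1))) ≤ R := by
    have e : x₂ / x₂ = 1 := div_self hx2pos.ne'
    rw [e]
    have u1 : A * (ρ * (1 + 17 / 41 * (1 - 1))) ≤ A * ca₂ := by
      have : ρ * (1 + 17 / 41 * (1 - 1)) = ρ := by ring
      rw [this]; exact mul_le_mul_of_nonneg_left hca₂ hA
    have u2 := mul_le_mul_of_nonneg_left hcb₂ hB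
    linarith [E2]
  have e : ∀ t : ℝ, A * (ρ * (1 + 17 / 41 * (t / x₂ - 1))) + B * (σ * (1 + 17 / 41 * ((1 - t) / (1 - x₁) - 1))) =
      (A * ρ * (1 - 17 / 41) + B * σ * (1 + 17 / 41 * (1 / (1 - x₁) - 1))) +
        (A * ρ * (17 / 41) / x₂ - B * σ * (17 / 41) / (1 - x₁)) * t := by
    intro t; field_simp; ring
  rw [e] at M P1 P2
  exact M.trans (FarEdgeDescentCriterionCells.lin_cell P1 P2 hx1 hx2)

end Summit.MatrixMultiplication.MatrixMultiplication.Theorems.FarEdgeDescentSlabTools
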